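import Mathlib
import HarnessLib
import Literature.Analysis.FluidPDE.SelfSimilar
import Literature.Analysis.FluidPDE.ClassicalSolution
import Literature.Analysis.FluidPDE.ClassicalSolutionCalculus
import Literature.Analysis.FluidPDE.Vorticity
import Literature.Analysis.FluidPDE.VectorCalculus
import Literature.Analysis.FluidPDE.VorticityCalculus
import Literature.Analysis.FluidPDE.NSBoundedMildOseenClassical
import Literature.Analysis.FluidPDE.AxisymmetricEuler
import Literature.Analysis.FluidPDE.AxisymmetricVorticityTransport
import Summits.NavierStokesRegularity.NavierStokesRegularity.Theorems.UnthreadedDoorNetFluxDefs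
import Summits.NavierStokesRegularity.NavierStokesRegularity.Theorems.UnthreadedDoorVorticityOfClass
import Summits.NavierStokesRegularity.NavierStokesRegularity.Theorems.UnthreadedDoorCellFluxZDefs
import Summits.NavierStokesRegularity.NavierStokesRegularity.Theorems.UnthreadedDoorCellFluxZonalKinematic
import Summits.NavierStokesRegularity.NavierStokesRegularity.Theorems.UnthreadedDoorCellFluxAxisFrozenStatics
import Summits.NavierStokesRegularity.NavierStokesRegularity.Theorems.UnthreadedDoorCellFluxAxisFrozenFrame
import Summits.NavierStokesRegularity.NavierStokesRegularity.Theorems.UnthreadedDoorCellFluxAxisFrozenPackage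

/-!
# Route `UnthreadedDoor`, crux `PoloidalLiouville` (stmt-NavierStokesRegularity-1222), WALL W1 — cell-flux Z skeleton, stub Z-1b `AxisFrozen` PROVED
# (`Cruxes/PoloidalLiouville/CellFluxZSkeleton.lean` v1.1 c6ae0be7f8d8, custodian ns-idea-14 g6; critic ns-wall-crit-1 V22)

`axisFrozen : CellFlux.AxisFrozen` (the Theorems-side twin, body VERBATIM the skeleton's `ZSkeleton.AxisFrozen`): for an unthreaded bounded ancient mild
solution, smooth on the slab, which at EVERY time is axisymmetric without swirl about SOME axis through `x₀` after subtracting SOME constant, and whose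
vorticity does not vanish identically at any time `t ≤ t₁ < 0`, there is ONE frame `R` in which `v t` ITSELF is axisymmetric without swirl for all `t ≤ t₁`.

PROOF (dynamic axis freezing).  (1) `frame_package` (`…AxisFrozenPackage`): per-time direction `e(t)` with `ω ⊥ e`, `∂ₜω ⊥ e`, uniqueness, `v t x₀ ∥ e(t)`,
partners, spanning.  (2) `dir_locally_constant`: near `t₀ ≤ t₁` the `C¹` vector `d(s) := ω(s,x₁) × ω(s,x₂)` is a non-zero multiple of `e(s)`; differentiating
`⟪d(s), ω(s,x)⟫ ≡ 0` and using `⟪e(s), ∂ₛω⟫ = 0` gives `ḋ ⊥ ω(s,·)`, hence `ḋ ∥ d`, hence `⟪d, d(t₀)⟫⁻¹ • d` is constant (`constant_of_derivWithin_zero`).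
(3) A locally constant direction class on `(-∞, t₁]` is constant (`IsLocallyConstant` of `s ↦ [e (min s t₁) ∥ e t₁]` on `ℝ`).  (4) In the canonical frame
`R₁` of `e₁ := e(t₁)` (`exists_frame`) every `v t − v t x₀`, `t ≤ t₁`, is axisymmetric swirl-free, and `v t x₀ ∥ e₁` is vertical there.

WHAT THIS IS NOT: the last of four stubs of Z (`ZonalUnthreadedVorticityVanishes`, information-grade for W1, critic V22-P6 (a)); `PoloidalLiouville` (1222),
W1 and NS regularity stay OPEN.  `--supports stmt-NavierStokesRegularity-1222 --as helper`.  [folklore]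
-/

noncomputable section

-- the summit and its single sub-problem share the name (CONVENTIONS §1)
set_option linter.dupNamespace false

open Set Function Filter Topology MeasureTheory Metric InnerProductSpace
open scoped RealInnerProductSpace InnerProductSpace

namespace Summit.NavierStokesRegularity.NavierStokesRegularity.Theorems.PoloidalLiouville.CellFlux

open Summit.NavierStokesRegularity.NavierStokesRegularity.Theorems.PoloidalLiouville.NetFlux (E3)
open Literature.Analysis Literature.Analysis.FluidPDE

/-! ### §1 Local constancy of the direction -/

/-- `a × b ⟂ a` (coordinates). -/
private theorem inner_cross_self_left'' (a b : E3) : ⟪cross a b, a⟫ = 0 := by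
  simp only [cross, PiLp.inner_apply, cross_apply, RCLike.inner_apply, conj_trivial,
    Fin.sum_univ_three, Matrix.cons_val_zero, Matrix.cons_val_one, Matrix.cons_val_two,
    Matrix.head_cons, Matrix.tail_cons]
  ring

/-- `a × b ⟂ b` (coordinates). -/
private theorem inner_cross_self_right'' (a b : E3) : ⟪cross a b, b⟫ = 0 := by
  simp only [cross, PiLp.inner_apply, cross_apply, RCLike.inner_apply, conj_trivial,
    Fin.sum_univ_three, Matrix.cons_val_zero, Matrix.cons_val_one, Matrix.cons_val_two,
    Matrix.head_cons, Matrix.tail_cons]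
  ring


section Local

variable {v : ℝ → E3 → E3}

/-- **The zonal direction is locally constant in time.**  Inputs: joint smoothness (for the vorticity and its time derivative), non-vanishing vorticity on
`(-∞, t₁]`, and the per-time package (the direction need not be assumed non-zero here).  The `C¹` vector `d(s) = ω(s,x₁) × ω(s,x₂)` is a non-zero multiple of `e(s)` near `t₀`; `⟪d(s), ω(s,x)⟫ ≡ 0` and
`⟪e(s), ∂ₛω(s,x)⟫ = 0` give `ḋ ⊥ ω(s,·)`, so `ḋ ∥ d` and `⟪d, d(t₀)⟫⁻¹ • d` is constant. [folklore] -/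
theorem dir_locally_constant (hsm : ContDiffOn ℝ (⊤ : ℕ∞) (uncurry v) (Iio 0 ×ˢ univ)) {t₁ : ℝ} (ht₁ : t₁ < 0)
    (hnz : ∀ t ≤ t₁, ∃ x, curl (v t) x ≠ 0) (e : ℝ → E3)
    (hP2 : ∀ t ≤ t₁, ∀ x, ⟪e t, timeDerivWithin (Iio 0) (vorticity v) t x⟫ = 0)
    (hP4 : ∀ t ≤ t₁, ∀ d : E3, (∀ x, ⟪d, curl (v t) x⟫ = 0) → ∃ μ : ℝ, d = μ • e t)
    (hP6 : ∀ t ≤ t₁, ∀ x₁, ∃ x₂, ‖curl (v t) x₂‖ = ‖curl (v t) x₁‖ ∧ ⟪curl (v t) x₁, curl (v t) x₂⟫ = 0)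
    (hP7 : ∀ t ≤ t₁, ∀ (x₁ x₂ d : E3), ‖curl (v t) x₁‖ ^ 2 * ‖curl (v t) x₂‖ ^ 2 - ⟪curl (v t) x₁, curl (v t) x₂⟫ ^ 2 ≠ 0 →
        ⟪d, curl (v t) x₁⟫ = 0 → ⟪d, curl (v t) x₂⟫ = 0 → ∀ x, ⟪d, curl (v t) x⟫ = 0)
    {t₀ : ℝ} (ht₀ : t₀ ≤ t₁) :
    ∃ δ > 0, ∀ s, t₀ - δ < s → s < t₀ + δ → s ≤ t₁ → ∃ ρ : ℝ, e s = ρ • e t₀ := by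
  have hsm' : IsSmoothSpaceTimeOn (Iio 0) v := hsm
  have hvort : IsSmoothSpaceTimeOn (Iio 0) (vorticity v) := hsm'.isSmoothSpaceTimeOn_vorticity (uniqueDiffOn_Iio 0)
  have ht₀0 : t₀ < 0 := lt_of_le_of_lt ht₀ ht₁
  -- two points with orthogonal vorticity vectors of equal non-zero length at time `t₀`
  obtain ⟨x₁, hx₁⟩ := hnz t₀ ht₀
  obtain ⟨x₂, hn, horth⟩ := hP6 t₀ ht₀ x₁
  -- the curves `a`, `b`, `d = a × b`
  set a : ℝ → E3 := fun s => vorticity v s x₁ with ha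
  set b : ℝ → E3 := fun s => vorticity v s x₂ with hb
  set d : ℝ → E3 := fun s => cross (a s) (b s) with hd
  set d₀ : E3 := d t₀ with hd₀
  have ha_eq : ∀ s, a s = curl (v s) x₁ := fun s => rfl
  have hb_eq : ∀ s, b s = curl (v s) x₂ := fun s => rfl
  -- `d₀ ≠ 0`: `‖a × b‖ = ‖a‖‖b‖ sin(π/2)`
  have hna0 : ‖a t₀‖ ≠ 0 := by rw [ha_eq]; exact norm_ne_zero_iff.2 hx₁
  have hd₀pos : 0 < ⟪d₀, d₀⟫ := by
    rw [real_inner_self_eq_norm_sq]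
    have hangle : InnerProductGeometry.angle (a t₀) (b t₀) = Real.pi / 2 :=
      (InnerProductGeometry.inner_eq_zero_iff_angle_eq_pi_div_two (a t₀) (b t₀)).1 horth
    have hnorm : ‖d₀‖ = ‖a t₀‖ * ‖a t₀‖ := by
      rw [hd₀, hd]
      simp only
      rw [norm_cross, hangle, Real.sin_pi_div_two, mul_one, hb_eq, hn, ← ha_eq]
    rw [hnorm]
    positivity
  -- continuity of `a`, `b` at `t₀`
  have hcont : ∀ x : E3, ContinuousAt (fun s => vorticity v s x) t₀ := by
    intro x
    have hg : ContinuousOn (fun s => vorticity v s x) (Iio 0) :=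
      hvort.continuousOn.comp (continuousOn_id.prodMk continuousOn_const) fun s hs => ⟨hs, mem_univ _⟩
    exact hg.continuousAt (Iio_mem_nhds ht₀0)
  have hca : ContinuousAt a t₀ := hcont x₁
  have hcb : ContinuousAt b t₀ := hcont x₂
  have hcd : ContinuousAt d t₀ := by
    have := (crossCLM.continuous₂.continuousAt).comp (hca.prodMk hcb)
    simpa [hd, Function.comp_def] using this
  -- the Gram determinant and `⟪d, d₀⟫` stay positive near `t₀`
  set Gf : ℝ → ℝ := fun s => ‖a s‖ ^ 2 * ‖b s‖ ^ 2 - ⟪a s, b s⟫ ^ 2 with hGf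
  have hGf0 : 0 < Gf t₀ := by
    have hapos : 0 < ‖a t₀‖ := lt_of_le_of_ne (norm_nonneg _) (Ne.symm hna0)
    have hbt : ‖b t₀‖ = ‖a t₀‖ := by rw [hb_eq, hn, ← ha_eq]
    have h4 : 0 < ‖a t₀‖ ^ 2 * ‖a t₀‖ ^ 2 := by positivity
    have horth' : ⟪a t₀, b t₀⟫ = 0 := horth
    show 0 < ‖a t₀‖ ^ 2 * ‖b t₀‖ ^ 2 - ⟪a t₀, b t₀⟫ ^ 2
    rw [horth', hbt]
    nlinarith [h4]
  have hcG : ContinuousAt Gf t₀ := by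
    simp only [hGf]
    exact ((hca.norm.pow 2).mul (hcb.norm.pow 2)).sub ((hca.inner hcb).pow 2)
  have hcI : ContinuousAt (fun s => ⟪d s, d₀⟫) t₀ := hcd.inner continuousAt_const
  have hev : ∀ᶠ s in 𝓝 t₀, 0 < Gf s ∧ 0 < ⟪d s, d₀⟫ :=
    (hcG.eventually (isOpen_Ioi.mem_nhds hGf0)).and (hcI.eventually (isOpen_Ioi.mem_nhds hd₀pos))
  obtain ⟨δ, hδ, hδball⟩ := Metric.eventually_nhds_iff.1 hev
  -- the interval `J = [t₀ − δ/2, min t₁ (t₀ + δ/2)]`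
  set α : ℝ := t₀ - δ / 2 with hα
  set β : ℝ := min t₁ (t₀ + δ / 2) with hβ
  have hαβ : α < β := by
    rw [hα, hβ, lt_min_iff]
    constructor <;> linarith
  have hJball : ∀ s ∈ Icc α β, 0 < Gf s ∧ 0 < ⟪d s, d₀⟫ := by
    intro s hs
    apply hδball
    rw [Real.dist_eq, abs_sub_lt_iff]
    have h1 := hs.1
    have h2 : s ≤ t₀ + δ / 2 := hs.2.trans (min_le_right _ _)
    constructor <;> linarith
  have hJle : ∀ s ∈ Icc α β, s ≤ t₁ := fun s hs => hs.2.trans (min_le_left _ _)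
  have hJneg : ∀ s ∈ Icc α β, s < 0 := fun s hs => lt_of_le_of_lt (hJle s hs) ht₁
  have ht₀J : t₀ ∈ Icc α β := ⟨by rw [hα]; linarith, le_min ht₀ (by linarith)⟩
  -- (ii) on `J`, `d(s)` is orthogonal to every vorticity vector, hence a non-zero multiple of `e(s)`
  have hdperp : ∀ s ∈ Icc α β, ∀ x, ⟪d s, curl (v s) x⟫ = 0 := by
    intro s hs x
    refine hP7 s (hJle s hs) x₁ x₂ (d s) (ne_of_gt (hJball s hs).1) ?_ ?_ x
    · exact inner_cross_self_left'' _ _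
    · exact inner_cross_self_right'' _ _
  have hdmul : ∀ s ∈ Icc α β, ∃ μ : ℝ, μ ≠ 0 ∧ d s = μ • e s := by
    intro s hs
    obtain ⟨μ, hμ⟩ := hP4 s (hJle s hs) (d s) (hdperp s hs)
    refine ⟨μ, ?_, hμ⟩
    rintro rfl
    rw [zero_smul] at hμ
    have := (hJball s hs).2
    rw [hμ, inner_zero_left] at this
    exact lt_irrefl _ this
  -- (iv) derivatives within `J`
  have hUD : UniqueDiffOn ℝ (Icc α β) := uniqueDiffOn_Icc hαβ
  have hderiv_ab : ∀ s ∈ Icc α β, ∀ x : E3,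
      HasDerivWithinAt (fun σ => vorticity v σ x) (timeDerivWithin (Iio 0) (vorticity v) s x) (Icc α β) s := by
    intro s hs x
    have h1 : HasDerivWithinAt (fun σ => vorticity v σ x) (timeDerivWithin (Iio 0) (vorticity v) s x) (Iio 0) s :=
      hvort.hasDerivWithinAt_timeDerivWithin (uniqueDiffOn_Iio 0) (hJneg s hs) x
    exact (h1.hasDerivAt (Iio_mem_nhds (hJneg s hs))).hasDerivWithinAt
  -- the derivative of `d` and its orthogonality to the vorticity
  have hkey : ∀ s ∈ Icc α β, ∃ d' : E3, HasDerivWithinAt d d' (Icc α β) s ∧ ∃ l : ℝ, d' = l • d s := by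
    intro s hs
    have hdd : HasDerivWithinAt d (cross (a s) (timeDerivWithin (Iio 0) (vorticity v) s x₂) +
        cross (timeDerivWithin (Iio 0) (vorticity v) s x₁) (b s)) (Icc α β) s :=
      crossCLM.hasDerivWithinAt_of_bilinear (hderiv_ab s hs x₁) (hderiv_ab s hs x₂)
    set d' : E3 := cross (a s) (timeDerivWithin (Iio 0) (vorticity v) s x₂) +
        cross (timeDerivWithin (Iio 0) (vorticity v) s x₁) (b s) with hd'
    refine ⟨d', hdd, ?_⟩
    -- `⟪d', ω(s,x)⟫ = 0` for every `x`
    obtain ⟨μ, hμ0, hμ⟩ := hdmul s hs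
    have hd'perp : ∀ x, ⟪d', curl (v s) x⟫ = 0 := by
      intro x
      have hω := hderiv_ab s hs x
      have hprod : HasDerivWithinAt (fun σ => ⟪d σ, vorticity v σ x⟫)
          (⟪d s, timeDerivWithin (Iio 0) (vorticity v) s x⟫ + ⟪d', vorticity v s x⟫) (Icc α β) s :=
        hdd.inner ℝ hω
      have hzero : HasDerivWithinAt (fun σ => ⟪d σ, vorticity v σ x⟫) 0 (Icc α β) s :=
        (hasDerivWithinAt_const s (Icc α β) (0 : ℝ)).congr_of_mem (fun σ hσ => hdperp σ hσ x) hs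
      have huniq := (hUD s hs).eq_deriv _ hprod hzero
      have h2 : ⟪d s, timeDerivWithin (Iio 0) (vorticity v) s x⟫ = 0 := by
        rw [hμ, inner_smul_left, hP2 s (hJle s hs) x]
        simp
      rw [h2, zero_add] at huniq
      exact huniq
    obtain ⟨ν, hν⟩ := hP4 s (hJle s hs) d' hd'perp
    refine ⟨ν / μ, ?_⟩
    rw [hν, hμ, smul_smul, div_mul_cancel₀ ν hμ0]
  -- the normalised vector `G = ⟪d, d₀⟫⁻¹ • d` has zero derivative within `J`
  set G : ℝ → E3 := fun σ => (⟪d σ, d₀⟫)⁻¹ • d σ with hG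
  have hGderiv : ∀ s ∈ Icc α β, HasDerivWithinAt G 0 (Icc α β) s := by
    intro s hs
    obtain ⟨d', hdd, l, hl⟩ := hkey s hs
    have hI : HasDerivWithinAt (fun σ => ⟪d σ, d₀⟫) (⟪d', d₀⟫) (Icc α β) s := by
      have := hdd.inner ℝ (hasDerivWithinAt_const s (Icc α β) d₀)
      simpa using this
    have hne : ⟪d s, d₀⟫ ≠ 0 := ne_of_gt (hJball s hs).2
    have hinv : HasDerivWithinAt (fun σ => (⟪d σ, d₀⟫)⁻¹) (-⟪d', d₀⟫ / ⟪d s, d₀⟫ ^ 2) (Icc α β) s := hI.inv hne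
    have hG' : HasDerivWithinAt G ((⟪d s, d₀⟫)⁻¹ • d' + (-⟪d', d₀⟫ / ⟪d s, d₀⟫ ^ 2) • d s) (Icc α β) s :=
      hinv.smul hdd
    have hzero : (⟪d s, d₀⟫)⁻¹ • d' + (-⟪d', d₀⟫ / ⟪d s, d₀⟫ ^ 2) • d s = 0 := by
      rw [hl, inner_smul_left, smul_smul, ← add_smul]
      have : (⟪d s, d₀⟫)⁻¹ * l + -((starRingEnd ℝ) l * ⟪d s, d₀⟫) / ⟪d s, d₀⟫ ^ 2 = 0 := by
        simp only [conj_trivial]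
        field_simp
        ring
      rw [this, zero_smul]
    rw [hzero] at hG'
    exact hG'
  have hGconst : ∀ s ∈ Icc α β, G s = G α := by
    refine constant_of_derivWithin_zero (fun s hs => (hGderiv s hs).differentiableWithinAt) fun s hs => ?_
    exact (hGderiv s (Ico_subset_Icc_self hs)).derivWithin (hUD s (Ico_subset_Icc_self hs))
  -- conclusion
  refine ⟨δ / 2, by linarith, fun s hs1 hs2 hs3 => ?_⟩
  have hsJ : s ∈ Icc α β := ⟨by rw [hα]; linarith, le_min hs3 (by linarith)⟩
  have hGs : G s = G t₀ := by rw [hGconst s hsJ, hGconst t₀ ht₀J]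
  obtain ⟨μs, hμs0, hμs⟩ := hdmul s hsJ
  obtain ⟨μ₀, _, hμ₀⟩ := hdmul t₀ ht₀J
  have hne : ⟪d s, d₀⟫ ≠ 0 := ne_of_gt (hJball s hsJ).2
  -- `d s = (⟪d s, d₀⟫ * ⟪d₀, d₀⟫⁻¹) • d₀`
  have hds : d s = (⟪d s, d₀⟫ * (⟪d₀, d₀⟫)⁻¹) • d₀ := by
    have h1 : (⟪d s, d₀⟫)⁻¹ • d s = (⟪d₀, d₀⟫)⁻¹ • d₀ := by
      have := hGs
      simpa [hG, hd₀] using this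
    have h2 := congrArg (fun w : E3 => ⟪d s, d₀⟫ • w) h1
    simp only [smul_smul, mul_inv_cancel₀ hne, one_smul] at h2
    exact h2
  have hes : e s = μs⁻¹ • d s := by
    rw [hμs, smul_smul, inv_mul_cancel₀ hμs0, one_smul]
  have hd₀' : d₀ = μ₀ • e t₀ := by rw [hd₀]; exact hμ₀
  have hes' : e s = (μs⁻¹ * (⟪d s, d₀⟫ * (⟪d₀, d₀⟫)⁻¹)) • d₀ := by
    conv_lhs => rw [hes, hds, smul_smul]
  generalize hκ : μs⁻¹ * (⟪d s, d₀⟫ * (⟪d₀, d₀⟫)⁻¹) = κ₀ at hes'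
  refine ⟨κ₀ * μ₀, ?_⟩
  rw [hes', hd₀', smul_smul]

end Local

/-! ### §2 Z-1b -/

/-- **Z-1b `AxisFrozen` (cell-flux Z skeleton v1.1; the Theorems-side twin `CellFlux.AxisFrozen`, body VERBATIM).**  See the module docstring for the
proof (per-time frame package, local then global constancy of the zonal direction, the canonical frame of the frozen direction, vertical constants).
[folklore] -/
theorem axisFrozen : AxisFrozen := by
  intro v x₀ T hB _hmeas hsm hlink hframe t₁ ht₁ hnz
  have hsm' : IsSmoothSpaceTimeOn (Iio 0) v := hsm
  -- the per-time package, as functions of `t`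
  have hpack := frame_package hB hsm hlink hframe ht₁ hnz
  choose e he using hpack
  have he0 : ∀ t ≤ t₁, e t ≠ 0 := fun t ht => (he t ht).1
  have hP1 : ∀ t ≤ t₁, ∀ x, ⟪e t, curl (v t) x⟫ = 0 := fun t ht => (he t ht).2.1
  have hP2 : ∀ t ≤ t₁, ∀ x, ⟪e t, timeDerivWithin (Iio 0) (vorticity v) t x⟫ = 0 := fun t ht => (he t ht).2.2.1
  have hP4 : ∀ t ≤ t₁, ∀ d : E3, (∀ x, ⟪d, curl (v t) x⟫ = 0) → ∃ μ : ℝ, d = μ • e t := fun t ht => (he t ht).2.2.2.1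
  have hP5 : ∀ t ≤ t₁, ∃ κ : ℝ, v t x₀ = κ • e t := fun t ht => (he t ht).2.2.2.2.1
  have hP6 := fun t (ht : t ≤ t₁) => (he t ht).2.2.2.2.2.1
  have hP7 := fun t (ht : t ≤ t₁) => (he t ht).2.2.2.2.2.2
  -- local constancy of the direction
  have hloc : ∀ t₀ ≤ t₁, ∃ δ > 0, ∀ s, t₀ - δ < s → s < t₀ + δ → s ≤ t₁ → ∃ ρ : ℝ, e s = ρ • e t₀ :=
    fun t₀ ht₀ => dir_locally_constant hsm ht₁ hnz e hP2 hP4 hP6 hP7 ht₀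
  -- global constancy on `(-∞, t₁]` via a locally constant predicate on `ℝ`
  have hglob : ∀ s ≤ t₁, ∃ ρ : ℝ, e s = ρ • e t₁ := by
    let f : ℝ → Prop := fun s => ∃ ρ : ℝ, e (min s t₁) = ρ • e t₁
    have hf : IsLocallyConstant f := by
      refine (IsLocallyConstant.iff_eventually_eq f).2 fun s₀ => ?_
      set m₀ : ℝ := min s₀ t₁ with hm₀
      have hm₀le : m₀ ≤ t₁ := min_le_right _ _
      obtain ⟨δ, hδ, hδloc⟩ := hloc m₀ hm₀le
      have hball : ∀ᶠ s in 𝓝 s₀, |s - s₀| < δ := by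
        have := Metric.ball_mem_nhds s₀ hδ
        filter_upwards [this] with s hs
        rwa [Metric.mem_ball, Real.dist_eq] at hs
      filter_upwards [hball] with s hs
      have hmin : |min s t₁ - m₀| < δ := by
        rw [hm₀]
        refine lt_of_le_of_lt (abs_min_sub_min_le_max s t₁ s₀ t₁) ?_
        simpa using hs
      rw [abs_sub_lt_iff] at hmin
      obtain ⟨ρ, hρ⟩ := hδloc (min s t₁) (by linarith) (by linarith) (min_le_right _ _)
      have hρ0 : ρ ≠ 0 := by
        rintro rfl
        rw [zero_smul] at hρ
        exact he0 (min s t₁) (min_le_right _ _) hρ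
      -- `f s ↔ f s₀`
      apply propext
      constructor
      · rintro ⟨ρ', hρ'⟩
        refine ⟨ρ⁻¹ * ρ', ?_⟩
        rw [← smul_smul, ← hρ', hρ, smul_smul, inv_mul_cancel₀ hρ0, one_smul]
      · rintro ⟨ρ₀, hρ₀⟩
        exact ⟨ρ * ρ₀, by rw [hρ, hρ₀, smul_smul]⟩
    intro s hs
    have hconst := hf.apply_eq_of_isPreconnected isPreconnected_univ (mem_univ s) (mem_univ t₁)
    have ht : f t₁ := ⟨1, by simp⟩
    have hfs : f s := by rw [hconst]; exact ht
    obtain ⟨ρ, hρ⟩ := hfs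
    rw [min_eq_left hs] at hρ
    exact ⟨ρ, hρ⟩
  -- the frozen direction and its canonical frame
  set e₁ : E3 := e t₁ with he₁
  have he₁0 : e₁ ≠ 0 := he0 t₁ le_rfl
  obtain ⟨R, hRe, hR⟩ := exists_frame x₀ he₁0
  refine ⟨R, fun t ht => ?_⟩
  have ht0 : t < 0 := lt_of_le_of_lt ht ht₁
  obtain ⟨ρ, hρ⟩ := hglob t ht
  have hρ0 : ρ ≠ 0 := by
    rintro rfl
    rw [zero_smul] at hρ
    exact he0 t ht hρ
  -- the slice `v t` meets the hypotheses of the frame construction for the direction `e₁`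
  have hvt : ContDiff ℝ (⊤ : ℕ∞) (v t) := hsm'.contDiff_slice ht0
  have hv2 : ContDiff ℝ 2 (v t) := hvt.of_le (by norm_cast)
  have hv1 : ContDiff ℝ 1 (v t) := hvt.of_le (by norm_cast)
  have hdiv : VectorCalculus.IsDivFree (v t) := (hB.isAncientMildSolution.1 t ht0).isDivFree_of_contDiff hv1
  obtain ⟨M, hM⟩ := hB.isBoundedOn
  have hperp : ∀ x, ⟪x - x₀, curl (v t) x⟫ = 0 := fun x => by
    rw [hlink t ht0 x, real_inner_comm]
    exact inner_cross_self_right'' _ _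
  have hzon : ∀ x, ⟪e₁, curl (v t) x⟫ = 0 := fun x => by
    have h := hP1 t ht x
    rw [hρ, inner_smul_left] at h
    simpa [hρ0] using h
  have hax : IsAxisymmetricNoSwirlAbout R x₀ (fun y => v t y - v t x₀) := hR (v t) M hv2 (fun x => hM t ht0 x) hdiv hperp hzon
  -- the constant `v t x₀` is along the axis
  obtain ⟨κ, hκ⟩ := hP5 t ht
  have hvert : R (v t x₀) = (κ * ρ * ‖e₁‖) • EuclideanSpace.single 2 (1 : ℝ) := by
    rw [hκ, hρ, map_smul, map_smul, hRe, smul_smul, smul_smul]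
  exact isAxisymmetricNoSwirlAbout_of_sub_vertical (κ * ρ * ‖e₁‖) hvert hax

end Summit.NavierStokesRegularity.NavierStokesRegularity.Theorems.PoloidalLiouville.CellFlux

end
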